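import Mathlib.MeasureTheory.VectorMeasure.Decomposition.Jordan
import Mathlib.MeasureTheory.Measure.Prod
import Mathlib.MeasureTheory.Integral.Bochner.Basic
import Mathlib.Analysis.SpecialFunctions.Trigonometric.Inverse
import Mathlib.Analysis.SpecialFunctions.Log.Basic
import Mathlib.Algebra.BigOperators.Finprod
import Literature.Probability.LatticeModels.RandomCluster
import Literature.Probability.LatticeModels.RandomClusterDomainMarkov
import Literature.Probability.Percolation.LoopRepresentation
import Literature.Probability.RandomPlanarGeometry.LoopWinding
import HarnessLib

/-!
# Gaussian limit of the `cos_μ`-twisted nesting field of critical FK(`q`) loops on `ℤ²` (DKLM 2026, Cor. 10)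

Duminil-Copin–Kozlowski–Lammers–Manolescu, *Gaussian free field convergence of the six-vertex
model with `-1 ≤ Δ ≤ -1/2`*, arXiv:2603.06268 (2026), prove (Theorem 8) that the height function
of the full-plane isotropic six-vertex model with `a = b = 1`, `√3 ≤ c ≤ 2` converges to `σ·GFF`,
`σ² = 2 / arccos Δ`. Through the Baxter–Kelland–Wu correspondence (their §3.2, display before
Cor. 10: `E^{6V}[e^{i⟨h^{(δ)},φ⟩}] = φ_{δℤ²,q}[∏_{ℓ ∈ 𝓛} cos_μ(φ(int ℓ))]`) this yields the
random-cluster statement vendored here as a NAMED FACT (`dklm2026_corollary10`):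

> **Corollary 10.** Fix `q ∈ [1, 4]`. For every finite Dirichlet energy generalized test function
> `φ`, `lim_{δ → 0} φ_{δℤ²,q}[∏_{ℓ ∈ 𝓛} cos_μ(φ(int(ℓ)))] = exp(-½ σ² ∬ G_{ℝ²}(x,y) φ(x) φ(y) dx dy)`,
> where `σ² = 2 / arccos(-√q/2)`,

with `μ = arccos(√q/2) / 2π`, `cos_μ(x) = cos(x + 2πμ) / cos(2πμ)`, `φ_{δℤ²,q}` the law of the loop
ensemble `𝓛` of the critical random-cluster measure with cluster weight `q`, `int(ℓ)` the interior
of the loop `ℓ`, `G_{ℝ²}(x, y) = -(1/2π) log |y - x|` (their (2.3)), and a *generalised test function*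
being a finite, compactly supported, signed measure `φ` on `ℝ²` with `φ(ℝ²) = 0` (their Def. 5), of
*finite Dirichlet energy* when `∫ G_{ℝ²}(u,v) dφ(u) dφ(v) < ∞` (Def. 6(ii)). At `q = 1` (critical
bond percolation, `p = 1/2`): `μ = 1/6`, `cos_μ(x) = 2 cos(x + π/3)`, `σ² = 3/π`
(`cosMu_one`, `dklmSigmaSq_one`, `rcSelfDualPoint_one`).

## Lean rendering (what each printed object becomes)

* **The measure.** `φ_{ℤ²,q}` is read on bond configurations of `ℤ²` (mesh `1`; the mesh enters
  only through the drawing of the loops) as ANY probability measure `P` on `BondConfig (Site 2)`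
  that is the weak (= cylinder-event) limit of the FREE finite-volume random-cluster measures of
  the boxes `Λ_n = [-n, n]²` (`Literature.Probability.LatticeModels.rcMeasure` of
  `finsetGraph (zdGraph 2) (box 2 n)` with no wired vertex) at the self-dual point
  `p = p_sd(q) = √q/(1+√q)` (`rcSelfDualPoint`): the structure `IsFreeRandomClusterLimit`. The
  limit exists for every `p ∈ [0,1]`, `q ≥ 1` [cite: Grimmett2006, Thm. (4.19)(a)] and `P` is then
  determined by it (cylinder events are a generating π-system), so the universally quantified
  form is exactly the printed statement about `φ⁰_{p_sd(q),q}`; "critical" = "self-dual" because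
  `p_c(q) = p_sd(q)` on `ℤ²` for `q ≥ 1` (Beffara–Duminil-Copin 2012, conjectured as
  [cite: Grimmett2006, Conj. (6.15)]) and because the BKW identity behind Cor. 10 is an identity
  at the self-dual point; for `1 ≤ q ≤ 4` the free and wired measures coincide there
  [cite: DuminilCopinSidoraviciusTassionCMP2017, Thm. 1], so the choice of free boundary
  conditions is immaterial. No existence statement is vendored (it is not part of Cor. 10).
* **The loops and `int(ℓ)`.** The loop ensemble of `ω` drawn at mesh `δ` is the tree's loop
  representation `bondLoopConfig δ 0 ω` (`Literature.Probability.Percolation.LoopRepresentation`: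
  the interface loops `IsInterfaceLoop ω γ` between primal and dual clusters, as closed polylines
  through the edge midpoints of `δℤ²`, unbased, typed by orientation; we take both types). The
  paper draws the same loops "as continuous simple paths" (rounding the corners at which a
  polyline loop touches itself, i.e. at bridges) and lets `int(ℓ)` be the bounded complementary
  component; for the polyline drawing this is the set of points of non-zero winding number,
  `loopInterior u = {z | u.wind z ≠ 0}` (`Literature.Probability.RandomPlanarGeometry.LoopWinding`),
  which is the convention already used by the consumer route
  (`Summits/CriticalPhenomena/CardyFormulaZ2/Theses/CardyMagicRigidity.lean`, `MagicFormulaZ2`).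
  DKLM's `φ_{δℤ²,q}` places the random-cluster model on the diagonal lattice `δ𝕃(π/2)` so that the
  loops run along `δℤ²` itself (their §5, p. 37, following DKKMO arXiv:2012.11672 §1.4; the tree's
  rendering of that picture is `isoRectLoopConfig δ (π/2) = bondLoopConfig (√2 δ) (π/4)`); the
  convention used here (model on `δℤ²`, loops on its medial lattice, as in the consumer route)
  differs from it by the linear similarity `z ↦ √2 e^{iπ/4} z` [cite: arXiv201211672v2, §1.4] and
  a translation by half a mesh. Under the similarity the class of finite-energy generalised test
  functions is invariant and the right-hand side is unchanged (`G_{ℝ²}` is isometry-invariant and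
  `∬ log λ dφ dφ = 0` when `φ(ℝ²) = 0`), so it is absorbed by the change of variables
  `φ ↦ φ ∘ (similarity)`. The residual translation is NOT absorbed (review 2026-08-15): the
  source fixes the offset (six-vertex vertices at `ℤ²`, `h` read at the face of `(⌊x⌋, ⌊y⌋)`,
  §2.2, loops ON `δℤ² ∋ 0`), whereas `√2 e^{iπ/4} · (medial lattice of δℤ²) = δℤ² + (δ/2, δ/2)`,
  a `δ`-DEPENDENT shift; by translation invariance of the infinite-volume measure the statement
  below is thus the printed one for the translated test functions `τ_{a(δ)} φ`, `|a(δ)| = O(δ)`,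
  rather than for `φ` itself, and the printed Corollary (fixed `φ`) yields it only together
  with local uniformity of the limit in translates of `φ` — immediate in DKLM's proof (Thm. 8 (i)
  is uniform on compacts; (3.2) is an identity at every `δ`) but not part of the printed
  statement. No constant depends on the offset.
* **The product.** `∏_{ℓ ∈ 𝓛}` is `finprod` over the (unbased) loops: since `cos_μ(0) = 1`, only
  loops whose interior carries non-zero `φ`-mass contribute, and at mesh `δ > 0` these are among
  the finitely many loops meeting a ball containing the support of `φ` (`loopNestingWeight`).
* **Test functions.** `IsGeneralisedTestFunction φ`: a `SignedMeasure ℂ` (automatically finite)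
  with `|φ|((closedBall 0 R)ᶜ) = 0` for some `R` and `φ univ = 0`. `HasFiniteDirichletEnergy φ`:
  `G_{ℝ²}` is integrable for `|φ| ⊗ |φ|` and `|φ|` has no atoms — the honest reading of
  "`∫ G dφ dφ < ∞`" as a Lebesgue integral against the product of the signed measure with itself
  (`G_{ℝ²} = +∞` on the diagonal in the paper, `(-∞, ∞]`-valued; Mathlib's `Real.log 0 = 0` makes
  `fullPlaneGreen x x = 0`, whence the explicit no-atom clause). This class contains every
  bounded compactly supported density of total integral zero. `∬ G dφ dφ` itself is the iterated
  integral `dirichletEnergy φ` through the Jordan decomposition (`signedIntegral`).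
* **The limit.** `lim_{δ→0}` is `Filter.Tendsto … (𝓝[>] 0) (𝓝 …)` of the expectations
  `∫ ω, loopNestingWeight q φ δ ω ∂P`.

Nothing here is proved about the fact; the API consists of unfolding lemmas and the `q = 1`
constants. Deliberately NOT here: Theorem 8 itself (no six-vertex height function in the tree),
Theorem 11 (anisotropic weights), existence/uniqueness of the infinite-volume measure, and the
identification of `IsFreeRandomClusterLimit (1/2) 1` with `bondPercolation (zdGraph 2) half`.

## References

* H. Duminil-Copin, K. K. Kozlowski, P. Lammers, I. Manolescu, arXiv:2603.06268 (2026): Def. 5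
  (generalised test functions), (2.3) and Def. 6 (Green function, finite Dirichlet energy),
  Def. 7, Thm. 8, §3.2 (BKW identity, `μ`, `cos_μ`) and Corollary 10 (p. 13), §5 p. 37 (`φ_{δ𝕃(θ),q}`).
* G. Grimmett, *The Random-Cluster Model* (2006): §4.2 (4.11)–(4.12) (free box measures),
  Thm. (4.19)(a) (thermodynamic limit), (6.9) (self-dual point), Conj. (6.15).
* H. Duminil-Copin, V. Sidoravicius, V. Tassion, Comm. Math. Phys. 349 (2017), Thm. 1
  (continuity, `φ⁰ = φ¹` at `p_c` for `1 ≤ q ≤ 4`).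
* H. Duminil-Copin, K. K. Kozlowski, D. Krachun, I. Manolescu, M. Oulamara, arXiv:2012.11672v2,
  §1.2, §1.4 (loop representation; `𝕃(π/2)` vs `ℤ²`).
* R. J. Baxter, S. B. Kelland, F. Y. Wu, J. Phys. A 9 (1976) (BKW correspondence).
-/

noncomputable section

open MeasureTheory Set Filter
open scoped ENNReal Real Topology

namespace Literature.Probability.Percolation

open LatticeModels RandomPlanarGeometry

/-! ### The self-dual point and free infinite-volume random-cluster measures on `ℤ²` -/

/-- The self-dual point `p_sd(q) = √q / (1 + √q)` of the random-cluster model on `ℤ²`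
(Grimmett 2006, (6.9)); equal to the critical point `p_c(q)` for `q ≥ 1` (Beffara–Duminil-Copin
2012; Grimmett's Conjecture (6.15)). [cite: Grimmett2006, (6.9)] -/
def rcSelfDualPoint (q : ℝ) : ℝ := Real.sqrt q / (1 + Real.sqrt q)

/-- `p_sd(1) = 1/2`: at `q = 1` the critical random-cluster measure is critical bond percolation.
[cite: Grimmett2006, (6.9) and §6.2] -/
@[simp] theorem rcSelfDualPoint_one : rcSelfDualPoint 1 = 1 / 2 := by
  rw [rcSelfDualPoint, Real.sqrt_one]; norm_num

/-- `p_sd(q) ∈ [0, 1]` (it is a probability). [cite: Grimmett2006, (6.9)] -/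
theorem rcSelfDualPoint_mem_Icc (q : ℝ) : rcSelfDualPoint q ∈ Set.Icc (0 : ℝ) 1 := by
  have h := Real.sqrt_nonneg q
  refine ⟨div_nonneg h (by positivity), ?_⟩
  rw [rcSelfDualPoint, div_le_one (by positivity)]
  linarith

/-- The cylinder event of `ℤ²`-bond configurations prescribed on the finite edge set `E₀`:
"`ω ∩ E₀ = S ∩ E₀`". These events form a π-system generating the product σ-algebra on
`BondConfig (Site 2) = Set (Sym2 (Site 2))`. [cite: Grimmett2006, §4.1 (the σ-field 𝓕 generated by finite-dimensional cylinders)] -/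
def cylinderEvent (E₀ S : Finset (Sym2 (Site 2))) : Set (BondConfig (Site 2)) :=
  {ω | ∀ e ∈ E₀, (e ∈ ω ↔ e ∈ S)}

/-- Membership in `cylinderEvent`. [cite: Grimmett2006, §4.1] -/
@[simp] theorem mem_cylinderEvent_iff {E₀ S : Finset (Sym2 (Site 2))} {ω : BondConfig (Site 2)} :
    ω ∈ cylinderEvent E₀ S ↔ ∀ e ∈ E₀, (e ∈ ω ↔ e ∈ S) := Iff.rfl

/-- The same cylinder event read on the bond configurations of a finite piece `Λ ⊆ ℤ²` (vertex
type `↥Λ`), an edge `e` of `ℤ²` being open in `ω : BondConfig ↥Λ` when it is the image of an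
open edge of `ω` under `Sym2.map Subtype.val` (the tree's `eOpen`, `RandomClusterShiftedBoxes`).
[cite: Grimmett2006, §4.2 (configurations on E_Λ)] -/
def pieceCylinderEvent (Λ : Finset (Site 2)) (E₀ S : Finset (Sym2 (Site 2))) :
    Set (BondConfig ↥Λ) :=
  {ω | ∀ e ∈ E₀, ((∃ e' ∈ ω, Sym2.map Subtype.val e' = e) ↔ e ∈ S)}

/-- Membership in `pieceCylinderEvent`. [cite: Grimmett2006, §4.2] -/
@[simp] theorem mem_pieceCylinderEvent_iff {Λ : Finset (Site 2)} {E₀ S : Finset (Sym2 (Site 2))}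
    {ω : BondConfig ↥Λ} :
    ω ∈ pieceCylinderEvent Λ E₀ S ↔ ∀ e ∈ E₀, ((∃ e' ∈ ω, Sym2.map Subtype.val e' = e) ↔ e ∈ S) :=
  Iff.rfl

/-- The free random-cluster measure `φ⁰_{Λ_n,p,q}` of the box `Λ_n = [-n, n]²` of `ℤ²`: the
random-cluster measure of the finite graph `(Λ_n, E_{Λ_n})` (`finsetGraph (zdGraph 2) (box 2 n)`)
with no wired vertex. [cite: Grimmett2006, §4.2 (4.11)–(4.12) with ξ = 0] -/
def rcFreeBoxMeasure (p q : ℝ) (n : ℕ) : Measure (BondConfig ↥(box 2 n)) :=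
  rcMeasure (finsetGraph (zdGraph 2) (box 2 n)) p q ∅

/-- `φ⁰_{Λ_n,p,q}` is a probability measure for `0 ≤ p ≤ 1`, `0 < q`. [cite: Grimmett2006, §4.2 (4.12)] -/
theorem isProbabilityMeasure_rcFreeBoxMeasure {p q : ℝ} (hp : p ∈ Set.Icc (0 : ℝ) 1) (hq : 0 < q)
    (n : ℕ) : IsProbabilityMeasure (rcFreeBoxMeasure p q n) :=
  isProbabilityMeasure_rcMeasure _ hp hq _

/-- **`P` is the free infinite-volume random-cluster measure `φ⁰_{p,q}` on `ℤ²`**, stated as a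
property: `P` is a probability measure on bond configurations of `ℤ²` whose cylinder-event
probabilities are the limits, as `Λ_n = [-n,n]² ↑ ℤ²`, of those of the free box measures
`φ⁰_{Λ_n,p,q}` (weak convergence, Grimmett 2006, §4.3). For `p ∈ [0,1]`, `q ≥ 1` such a `P`
exists (Thm. (4.19)(a), not vendored here) and is unique (cylinder events generate); at
`p = p_sd(q)`, `1 ≤ q ≤ 4`, it is the unique random-cluster measure (Duminil-Copin–Sidoravicius–
Tassion 2017). [cite: Grimmett2006, Thm. (4.19)(a) and (4.20)] -/
structure IsFreeRandomClusterLimit (p q : ℝ) (P : Measure (BondConfig (Site 2))) : Prop where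
  /-- `P` is a probability measure. -/
  isProbabilityMeasure : IsProbabilityMeasure P
  /-- Cylinder probabilities converge: `φ⁰_{Λ_n,p,q}(ω ∩ E₀ = S ∩ E₀) → P(ω ∩ E₀ = S ∩ E₀)`. -/
  tendsto_cylinder : ∀ E₀ S : Finset (Sym2 (Site 2)),
    Tendsto (fun n : ℕ ↦ (rcFreeBoxMeasure p q n).real (pieceCylinderEvent (box 2 n) E₀ S)) atTop
      (𝓝 (P.real (cylinderEvent E₀ S)))

/-! ### DKLM's constants `μ`, `cos_μ`, `σ²` -/

/-- DKLM's twist parameter `μ = arccos(√q / 2) / 2π` (§3.2, before Cor. 10); `μ = 1/6` at `q = 1`.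
[cite: DuminilCopinKozlowskiLammersManolescu2026, §3.2] -/
def dklmMu (q : ℝ) : ℝ := Real.arccos (Real.sqrt q / 2) / (2 * π)

/-- DKLM's twisted cosine `cos_μ(x) = cos(x + 2πμ) / cos(2πμ)` (§3.2, before Cor. 10), the loop
weight of the BKW identity; `cos_μ(0) = 1`. [cite: DuminilCopinKozlowskiLammersManolescu2026, §3.2] -/
def cosMu (q x : ℝ) : ℝ := Real.cos (x + 2 * π * dklmMu q) / Real.cos (2 * π * dklmMu q)

/-- DKLM's variance `σ² = 2 / arccos(-√q / 2)` of Cor. 10 (`= 2 / arccos Δ = 1 / arcsin(c/2)` of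
Thm. 8 with `Δ = -√q/2`). [cite: DuminilCopinKozlowskiLammersManolescu2026, Cor. 10] -/
def dklmSigmaSq (q : ℝ) : ℝ := 2 / Real.arccos (-(Real.sqrt q / 2))

/-- `2πμ = arccos(√q/2)`. [cite: DuminilCopinKozlowskiLammersManolescu2026, §3.2] -/
theorem two_pi_mul_dklmMu (q : ℝ) : 2 * π * dklmMu q = Real.arccos (Real.sqrt q / 2) := by
  unfold dklmMu
  field_simp

/-- `cos(2πμ) = √q / 2` for `0 ≤ q ≤ 4`. [cite: DuminilCopinKozlowskiLammersManolescu2026, §3.2] -/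
theorem cos_two_pi_mul_dklmMu {q : ℝ} (hq : q ≤ 4) :
    Real.cos (2 * π * dklmMu q) = Real.sqrt q / 2 := by
  rw [two_pi_mul_dklmMu]
  have h0 : 0 ≤ Real.sqrt q := Real.sqrt_nonneg q
  have h2 : Real.sqrt q ≤ 2 := by
    rw [show (2 : ℝ) = Real.sqrt 4 by rw [show (4 : ℝ) = 2 ^ 2 by norm_num, Real.sqrt_sq (by norm_num)]]
    exact Real.sqrt_le_sqrt hq
  exact Real.cos_arccos (by linarith) (by linarith)

/-- `cos_μ(0) = 1` for `0 < q ≤ 4` (so loops whose interior carries no `φ`-mass do not contribute).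
[cite: DuminilCopinKozlowskiLammersManolescu2026, §3.2] -/
theorem cosMu_zero {q : ℝ} (hq0 : 0 < q) (hq : q ≤ 4) : cosMu q 0 = 1 := by
  rw [cosMu, zero_add, div_self]
  rw [cos_two_pi_mul_dklmMu hq]
  exact (div_pos (Real.sqrt_pos.2 hq0) two_pos).ne'

/-- `arccos(1/2) = π/3`. [folklore] -/
theorem arccos_one_half : Real.arccos (1 / 2) = π / 3 :=
  Real.arccos_eq_of_eq_cos (by positivity) (by linarith [Real.pi_pos]) (by rw [Real.cos_pi_div_three])

/-- `μ = 1/6` at `q = 1`. [cite: DuminilCopinKozlowskiLammersManolescu2026, §3.2] -/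
theorem dklmMu_one : dklmMu 1 = 1 / 6 := by
  rw [dklmMu, Real.sqrt_one, arccos_one_half]
  field_simp
  ring

/-- `cos_μ(x) = 2 cos(x + π/3)` at `q = 1` (the percolation loop weight of the consumer route
`CardyMagicRigidity.MagicFormulaZ2`). [cite: DuminilCopinKozlowskiLammersManolescu2026, §3.2] -/
theorem cosMu_one (x : ℝ) : cosMu 1 x = 2 * Real.cos (x + π / 3) := by
  rw [cosMu, two_pi_mul_dklmMu, Real.sqrt_one, arccos_one_half, Real.cos_pi_div_three]
  field_simp

/-- `σ² = 3/π` at `q = 1`. [cite: DuminilCopinKozlowskiLammersManolescu2026, Cor. 10 and Thm. 8] -/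
theorem dklmSigmaSq_one : dklmSigmaSq 1 = 3 / π := by
  rw [dklmSigmaSq, Real.sqrt_one, Real.arccos_neg, arccos_one_half]
  field_simp
  ring

/-! ### The full-plane Green function and test measures of finite Dirichlet energy -/

/-- The full-plane Green function `G_{ℝ²}(x, y) = -(1/2π) log |y - x|` (DKLM (2.3), `ℝ²` read as
`ℂ`). On the diagonal the paper's value is `+∞`; here `Real.log 0 = 0` gives the junk value `0`,
which is why `HasFiniteDirichletEnergy` excludes atoms explicitly.
[cite: DuminilCopinKozlowskiLammersManolescu2026, (2.3)] -/
def fullPlaneGreen (x y : ℂ) : ℝ := -(1 / (2 * π)) * Real.log ‖y - x‖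

/-- `G_{ℝ²}` is symmetric. [cite: DuminilCopinKozlowskiLammersManolescu2026, (2.3)] -/
theorem fullPlaneGreen_comm (x y : ℂ) : fullPlaneGreen x y = fullPlaneGreen y x := by
  rw [fullPlaneGreen, fullPlaneGreen, norm_sub_rev]

/-- The integral of a real function against a signed measure `φ` through its Jordan
decomposition `φ = φ⁺ - φ⁻`: `∫ f dφ := ∫ f dφ⁺ - ∫ f dφ⁻` (Bochner integrals, each `0` when
`f` is not integrable). Mathlib has the Jordan decomposition (`SignedMeasure.toJordanDecomposition`)
but no integral against signed measures. [folklore] -/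
def signedIntegral (φ : SignedMeasure ℂ) (f : ℂ → ℝ) : ℝ :=
  (∫ x, f x ∂φ.toJordanDecomposition.posPart) - ∫ x, f x ∂φ.toJordanDecomposition.negPart

/-- `∫ (c f) dφ = c ∫ f dφ`. [folklore] -/
theorem signedIntegral_const_mul (φ : SignedMeasure ℂ) (c : ℝ) (f : ℂ → ℝ) :
    signedIntegral φ (fun x ↦ c * f x) = c * signedIntegral φ f := by
  simp only [signedIntegral, integral_const_mul, mul_sub]

/-- DKLM's **generalised test functions** (Def. 5): finite (automatic for `SignedMeasure`),
compactly supported signed measures `φ` on the plane with total mass `φ(ℝ²) = 0`; compact support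
is `|φ|((closedBall 0 R)ᶜ) = 0` for some radius `R`, `|φ| = φ⁺ + φ⁻` the total variation.
[cite: DuminilCopinKozlowskiLammersManolescu2026, Def. 5] -/
structure IsGeneralisedTestFunction (φ : SignedMeasure ℂ) : Prop where
  /-- Compact support: no variation outside some closed ball. -/
  exists_totalVariation_compl_closedBall_eq_zero :
    ∃ R : ℝ, φ.totalVariation (Metric.closedBall (0 : ℂ) R)ᶜ = 0
  /-- Total mass zero, `φ(ℝ²) = 0`. -/
  apply_univ_eq_zero : φ Set.univ = 0

/-- **Finite Dirichlet energy** (DKLM Def. 6(ii): "`∫ G_{ℝ²}(u,v) dφ(u) dφ(v) < ∞`"), read as a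
Lebesgue integral against `φ ⊗ φ`: `G_{ℝ²}` is integrable for `|φ| ⊗ |φ|`, and — because `G_{ℝ²}`
is `+∞` on the diagonal whereas `fullPlaneGreen x x = 0` — `|φ|` has no atoms.
[cite: DuminilCopinKozlowskiLammersManolescu2026, Def. 6(ii)] -/
structure HasFiniteDirichletEnergy (φ : SignedMeasure ℂ) : Prop where
  /-- `|φ|` has no atoms. -/
  totalVariation_singleton : ∀ x : ℂ, φ.totalVariation {x} = 0
  /-- `G_{ℝ²} ∈ L¹(|φ| ⊗ |φ|)`. -/
  integrable_fullPlaneGreen :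
    Integrable (fun z : ℂ × ℂ ↦ fullPlaneGreen z.1 z.2) (φ.totalVariation.prod φ.totalVariation)

/-- The Dirichlet energy form `∬ G_{ℝ²}(x, y) dφ(x) dφ(y)` of a signed measure (DKLM Def. 6(ii),
`Σ(φ)` with one test function), as the iterated signed integral; for `φ` of finite Dirichlet
energy Fubini applies and the order is immaterial. [cite: DuminilCopinKozlowskiLammersManolescu2026, Def. 6(ii)] -/
def dirichletEnergy (φ : SignedMeasure ℂ) : ℝ :=
  signedIntegral φ fun x ↦ signedIntegral φ fun y ↦ fullPlaneGreen x y

/-- `∬ G dφ dφ = -(1/2π) ∬ log |x - y| dφ(x) dφ(y)`. [cite: DuminilCopinKozlowskiLammersManolescu2026, (2.3)] -/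
theorem dirichletEnergy_eq (φ : SignedMeasure ℂ) :
    dirichletEnergy φ =
      -(1 / (2 * π)) * signedIntegral φ fun x ↦ signedIntegral φ fun y ↦ Real.log ‖x - y‖ := by
  simp only [dirichletEnergy, fullPlaneGreen, norm_sub_rev _ (_ : ℂ), signedIntegral_const_mul]

/-! ### The loop nesting weight `∏_ℓ cos_μ(φ(int ℓ))` -/

/-- The interior `int(u)` of a planar loop `u`: the points of non-zero winding number (off the
trace; the winding number is `0` on the trace by convention). For a simple loop this is the bounded
complementary component; for the tree's polyline interface loops, which may touch themselves at
bridges, it is the interior of the paper's rounded simple drawing up to the rounding.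
[cite: DuminilCopinKozlowskiLammersManolescu2026, §3.2 (int(ℓ))] -/
def loopInterior (u : UnbasedLoop ℂ) : Set ℂ := {z | u.wind z ≠ 0}

/-- Membership in `loopInterior`. [cite: DuminilCopinKozlowskiLammersManolescu2026, §3.2] -/
@[simp] theorem mem_loopInterior_iff {u : UnbasedLoop ℂ} {z : ℂ} : z ∈ loopInterior u ↔ u.wind z ≠ 0 :=
  Iff.rfl

/-- DKLM's loop functional `A_φ(𝓛) = ∏_{ℓ ∈ 𝓛} cos_μ(φ(int ℓ))` (§3.2 and (5.4)) of the bond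
configuration `ω` of `ℤ²` drawn at mesh `δ`: the product over all loops `u` (both types) of the
loop representation `bondLoopConfig δ 0 ω` of `cos_μ(φ(int u))`. A `finprod`: it is the honest
finite product whenever all but finitely many factors equal `1`, which is the case for every `ω`
at `δ > 0` and `0 < q ≤ 4` since `cos_μ(0) = 1` and only the finitely many loops meeting a ball
carrying `|φ|` can have `φ(int u) ≠ 0`. [cite: DuminilCopinKozlowskiLammersManolescu2026, §3.2 and (5.4)] -/
def loopNestingWeight (q : ℝ) (φ : SignedMeasure ℂ) (δ : ℝ) (ω : BondConfig (Site 2)) : ℝ :=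
  ∏ᶠ u ∈ (bondLoopConfig δ 0 ω).F 0 ∪ (bondLoopConfig δ 0 ω).F 1, cosMu q (φ (loopInterior u))

/-- `loopNestingWeight` with the interior written out as `{z | u.wind z ≠ 0}` (the form used in
`CardyMagicRigidity.MagicFormulaZ2`). [cite: DuminilCopinKozlowskiLammersManolescu2026, §3.2] -/
theorem loopNestingWeight_eq (q : ℝ) (φ : SignedMeasure ℂ) (δ : ℝ) (ω : BondConfig (Site 2)) :
    loopNestingWeight q φ δ ω =
      ∏ᶠ u ∈ (bondLoopConfig δ 0 ω).F 0 ∪ (bondLoopConfig δ 0 ω).F 1,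
        cosMu q (φ {z | u.wind z ≠ 0}) :=
  rfl

/-- At `q = 1` the weight is `∏_u 2 cos(φ(int u) + π/3)`. [cite: DuminilCopinKozlowskiLammersManolescu2026, §3.2] -/
theorem loopNestingWeight_one (φ : SignedMeasure ℂ) (δ : ℝ) (ω : BondConfig (Site 2)) :
    loopNestingWeight 1 φ δ ω =
      ∏ᶠ u ∈ (bondLoopConfig δ 0 ω).F 0 ∪ (bondLoopConfig δ 0 ω).F 1,
        2 * Real.cos (φ {z | u.wind z ≠ 0} + π / 3) := by
  simp only [loopNestingWeight_eq, cosMu_one]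

/-! ### DKLM 2026, Corollary 10 (named fact) -/

/-- **DKLM 2026, Corollary 10 — Gaussian limit of the `cos_μ`-twisted nesting field of critical
FK(`q`) loops on `ℤ²`** (Duminil-Copin–Kozlowski–Lammers–Manolescu, arXiv:2603.06268, Cor. 10,
p. 13, as printed): "Fix `q ∈ [1,4]`. For every finite Dirichlet energy generalized test function
`φ`, `lim_{δ→0} φ_{δℤ²,q}[∏_{ℓ∈𝓛} cos_μ(φ(int(ℓ)))] = exp(-½σ² ∬ G_{ℝ²}(x,y) φ(x)φ(y) dx dy)`,
where `σ² = 2/arccos(-√q/2)`." Rendering (module docstring): `φ_{ℤ²,q}` = any free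
infinite-volume random-cluster limit `P` at the self-dual point `p_sd(q) = √q/(1+√q)`
(`IsFreeRandomClusterLimit`; unique, and equal to "the critical measure", by Grimmett Thm.
(4.19)(a), `p_c = p_sd` and DST 2017 — none of which is asserted here); loops = the tree's loop
representation `bondLoopConfig δ 0` with interiors by winding number; test functions =
compactly supported signed measures of mass zero with `G_{ℝ²} ∈ L¹(|φ|⊗|φ|)` and no atoms; the
expectation is the Bochner integral and the limit is along `δ → 0⁺` (up to the `O(δ)` lattice
offset discussed in the module docstring). A consequence of Thm. 8 (GFF limit of the six-vertex
height function, `Δ ∈ [-1,-1/2]`) through the BKW identity (3.2) of §3.2, for whose details the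
authors "refer to [magicformula]", their companion paper — also the source of their Thm. 12
(rotation invariance of the `k`-point functions), "a key external input" of the proof of Thm. 8 —
which is not public as of 2026-08 (review 2026-08-15: the public proof of Cor. 10 is incomplete
pending that companion; the printed one-line proof is formalised modulo its two inputs in
`FKLoopNestingGaussianGlue.dklm2026_corollary10_of_gaussianLimit`). The fact stays a cited
hypothesis: users take `(h : dklm2026_corollary10)`. [cite: DuminilCopinKozlowskiLammersManolescu2026, Cor. 10] -/
def dklm2026_corollary10 : Prop :=
  ∀ q ∈ Set.Icc (1 : ℝ) 4, ∀ P : Measure (BondConfig (Site 2)),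
    IsFreeRandomClusterLimit (rcSelfDualPoint q) q P →
    ∀ φ : SignedMeasure ℂ, IsGeneralisedTestFunction φ → HasFiniteDirichletEnergy φ →
      Tendsto (fun δ : ℝ ↦ ∫ ω, loopNestingWeight q φ δ ω ∂P) (𝓝[>] 0)
        (𝓝 (Real.exp (-(dklmSigmaSq q / 2) * dirichletEnergy φ)))

/-- **Corollary 10 at `q = 1` (critical bond percolation) with the constants evaluated**: for
every free infinite-volume random-cluster limit `P` at `(p, q) = (1/2, 1)` and every finite-energy
generalised test function `φ`,
`E_P[∏_u 2cos(φ(int u) + π/3)] → exp((3/4π²) ∬ log|x-y| dφ(x) dφ(y))` as the mesh `δ → 0⁺`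
(`σ² = 3/π`, `cos_μ = 2cos(· + π/3)`, `-½σ² · (-1/2π) = 3/(4π²)`).
[cite: DuminilCopinKozlowskiLammersManolescu2026, Cor. 10 (q = 1)] -/
theorem dklm2026_corollary10.q_one (h : dklm2026_corollary10) {P : Measure (BondConfig (Site 2))}
    (hP : IsFreeRandomClusterLimit (1 / 2) 1 P) {φ : SignedMeasure ℂ}
    (hφ : IsGeneralisedTestFunction φ) (hE : HasFiniteDirichletEnergy φ) :
    Tendsto
      (fun δ : ℝ ↦ ∫ ω, (∏ᶠ u ∈ (bondLoopConfig δ 0 ω).F 0 ∪ (bondLoopConfig δ 0 ω).F 1,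
        2 * Real.cos (φ {z | u.wind z ≠ 0} + π / 3)) ∂P)
      (𝓝[>] 0)
      (𝓝 (Real.exp (3 / (4 * π ^ 2) *
        signedIntegral φ fun x ↦ signedIntegral φ fun y ↦ Real.log ‖x - y‖))) := by
  have h1 := h 1 ⟨le_rfl, by norm_num⟩ P (by rwa [rcSelfDualPoint_one]) φ hφ hE
  simp only [loopNestingWeight_one, dklmSigmaSq_one, dirichletEnergy_eq] at h1
  convert h1 using 3
  field_simp
  ring

end Literature.Probability.Percolation

end
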